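import Summits.CriticalPhenomena.CardyFormulaZ2.Theorems.CardyIKTransportIKLinearTransportWallDominationDefs

/-!
# `CardyIKTransport.IKLinearTransport` (stmt-CriticalPhenomena-5076), line `pinned-diagram-exchange`, lead c8 —
# WALL DOMINATION, first application: THIN RINGS THROUGH THE WALL FOR EVERY COLUMN PATTERN (vocabulary + composition)

Definitions-only support file (`--supports stmt-CriticalPhenomena-5076`).  Nothing is asserted: `HonThinRingChain` is a statement the line
POSITS (a registered sub-goal — RSW + Harris for site percolation on `𝕋`, the sister line's `stub_triCylArcs` pattern), `TwoWallDomination`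
is the registered sub-goal of `…WallDominationDefs` (assembled in `…WallDomination.lean`); the composition `thinRingChain_all_of` is
sorry-free.

THE EVENT (`thinRingChain w₁ w₂ A B`, two-wall-monotone: `twoWallMonotone_thinRingChain`).  On the slab of `w₁ + w₂` face columns with
middle (wall) column `w₁`: there are wall rows `u, u' ∈ A` and `v, v' ∈ B` with `u` joined to `v` by a black path inside the RIGHT part,
`u'` joined to `v'` inside the LEFT part, `u'` chained to `u` through wall rows of `A` and `v'` to `v` through wall rows of `B`, each link of a
chain being a black connection inside the left part or inside the right part (`chainRel`).  This is exactly what four site-`𝕋` box crossings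
produce (a left–right crossing `H⁺` of the box of rows `A` across the whole slab, `H⁻` likewise for `B`, a bottom–top crossing of the left
part and one of the right part between them: `u'`/`u` = first/last wall visit of `H⁺`, the excursions of `H⁺` between consecutive wall
visits lie on one side each), and in the PLANE it is a black closed curve of winding number one around every white wall cell strictly between
the rows of `A` and of `B` (the chains stay in `A`, resp. `B`).  By `TwoWallDomination` its probability under EVERY face-type pattern is at
least its site-`𝕋` probability (`thinRingChain_all_of`).
-/

noncomputable section

namespace Summit.CriticalPhenomena.CardyFormulaZ2.Theorems.IKLinearTransport.PinnedDiagramExchange.WallDomination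

open scoped BigOperators Classical
open Summit.CriticalPhenomena.CardyFormulaZ2.Cruxes.IKMixedBoxCrossing.DefectClosureExploration

variable {L : ℕ}

/-! ## §1 The chained thin-ring event -/

/-- CHAINING THROUGH WALL ROWS OF `W`: the reflexive–transitive closure of "both rows lie in `W` and their middle cells are joined by a
black path inside the left part or inside the right part". -/
def chainRel (w₁ w₂ : ℕ) (W : Set (ZMod L)) (x : CylCfg (w₁ + w₂) L) : ZMod L → ZMod L → Prop :=
  Relation.ReflTransGen fun r s => r ∈ W ∧ s ∈ W ∧ ((r, s) ∈ leftRel w₁ w₂ x ∨ (r, s) ∈ rightRel w₁ w₂ x)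

/-- `chainRel` is increasing in the two profiles. -/
theorem chainRel_mono {w₁ w₂ : ℕ} (W : Set (ZMod L)) {x y : CylCfg (w₁ + w₂) L}
    (hl : leftRel w₁ w₂ x ⊆ leftRel w₁ w₂ y) (hr : rightRel w₁ w₂ x ⊆ rightRel w₁ w₂ y) {r s : ZMod L}
    (h : chainRel w₁ w₂ W x r s) : chainRel w₁ w₂ W y r s := by
  unfold chainRel at h ⊢
  refine Relation.ReflTransGen.mono (fun a b hab => ?_) _ _ h
  exact ⟨hab.1, hab.2.1, hab.2.2.imp (fun h => hl h) (fun h => hr h)⟩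

/-- THE CHAINED THIN-RING EVENT through the middle column `w₁` with upper window `A` and lower window `B` (see the file header). -/
def thinRingChain (w₁ w₂ : ℕ) (A B : Set (ZMod L)) : Set (CylCfg (w₁ + w₂) L) :=
  {x | ∃ u ∈ A, ∃ u' ∈ A, ∃ v ∈ B, ∃ v' ∈ B, (u, v) ∈ rightRel w₁ w₂ x ∧ (u', v') ∈ leftRel w₁ w₂ x ∧
    chainRel w₁ w₂ A x u' u ∧ chainRel w₁ w₂ B x v' v}

/-- The chained thin-ring event is two-wall-monotone. -/
theorem twoWallMonotone_thinRingChain (w₁ w₂ : ℕ) (A B : Set (ZMod L)) :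
    TwoWallMonotone w₁ w₂ (thinRingChain (L := L) w₁ w₂ A B) :=
  fun _ _ _ hl hr ⟨u, hu, u', hu', v, hv, v', hv', h1, h2, h3, h4⟩ =>
    ⟨u, hu, u', hu', v, hv, v', hv', hr h1, hl h2, chainRel_mono A hl hr h3, chainRel_mono B hl hr h4⟩

/-! ## §2 The windows of the cylinder of circumference `8n` and the statements -/

/-- Upper window: rows `[2n, 3n)`. -/
def winA (n L : ℕ) : Set (ZMod L) := {r | 2 * n ≤ r.val ∧ r.val < 3 * n}

/-- Lower window: rows `[5n, 6n)`. -/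
def winB (n L : ℕ) : Set (ZMod L) := {r | 5 * n ≤ r.val ∧ r.val < 6 * n}

/-- SITE-`𝕋` INPUT (RSW + Harris, the sister line's `stub_triCylArcs` pattern): on the ALL-HONEYCOMB slab of `n + n` face columns on the
cylinder of circumference `8n` the chained thin-ring event with windows `[2n,3n)`, `[5n,6n)` has probability `≥ c > 0` uniformly in `n ≥ 1`
(a left–right crossing of the sites `[0, 2n] × [2n, 3n)`, one of `[0, 2n] × [5n, 6n)`, a bottom–top crossing of `[0, n] × [2n, 6n)` and one of
`[n, 2n] × [2n, 6n)`: Harris–FKG for the uniform colouring, tree RSW at aspect `≤ 4`, and the gluing described in the header).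
  A statement to be proved (registered sub-goal), not asserted here. -/
def HonThinRingChain : Prop :=
  ∃ c : ℝ, 0 < c ∧ ∀ n : ℕ, 1 ≤ n → ∀ (L : ℕ) [NeZero L], L = 8 * n →
    c ≤ cylProb (n + n) L (fun _ => false) (thinRingChain n n (winA n L) (winB n L))

/-- **THIN RINGS THROUGH THE WALL FOR EVERY COLUMN PATTERN, from the two registered sub-goals** (no `sorry`): for every face-type
pattern `τ` on the slab of `n + n` face columns of the cylinder of circumference `8n`, the chained thin-ring event has probability `≥ c`, with
the site-`𝕋` constant `c`. -/
theorem thinRingChain_all_of : TwoWallDomination → HonThinRingChain →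
    ∃ c : ℝ, 0 < c ∧ ∀ n : ℕ, 1 ≤ n → ∀ (L : ℕ) [NeZero L], L = 8 * n → ∀ τ : Fin (n + n) → Bool,
      c ≤ cylProb (n + n) L τ (thinRingChain n n (winA n L) (winB n L)) := by
  intro hD hT
  obtain ⟨c, hc, h⟩ := hT
  refine ⟨c, hc, fun n hn L _ hL τ => (h n hn L hL).trans ?_⟩
  exact hD n n L (by omega) τ _ (twoWallMonotone_thinRingChain n n _ _)

namespace Registered

/-- Alias keyed by the registered sub-goal name (site-`𝕋` RSW + Harris + gluing). -/
abbrev stub_honThinRingChain : Prop := HonThinRingChain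

end Registered

end Summit.CriticalPhenomena.CardyFormulaZ2.Theorems.IKLinearTransport.PinnedDiagramExchange.WallDomination

end
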